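import Mathlib
import HarnessLib
import Summits.Ventures.LatticeQCDFlow.Exactness.KennedyPendletonSampler

/-!
# Creutz's `a₀` draw is exact: inverse-CDF proposal `∝ e^{bt·a₀}` on `[−1,1]`, thinning by `√(1−a₀²)`

HONEST FRAMING: exact (Metropolis-corrected) sampling algorithms for lattice gauge theory;
figures of merit are autocorrelation/cost numbers at stated couplings and volumes; no
continuum-physics claim.

Venture `LatticeQCDFlow` (cell pub-lqcd), topic `Exactness`, FANOUT row 9 (eng-latcore, the
engine `latflow.core`).  NEW WORK of the cell over Mathlib and row 9's files
`KennedyPendletonSampler.lean` (A3's law `a0Law`, the acceptance test `unitLaw_sq_le`),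
`RejectionSampling.lean` (the loop) and `SU2HeatBathSampler.lean` (assembly).  Nothing here is
cited as a fact.  Printed counterparts, NAMED ONLY: Creutz, Phys. Rev. D 21 (1980) 2308, §III;
Kennedy–Pendleton 1985 (who replace this branch at large `bt`).

The engine's SECOND branch of `sample_a0` (`csrc/latcore_template.c`, `bt < KP_SWITCH = 2`;
`updates.py` `sample_a0_creutz`) reads two uniforms `(r, r₂)` per round: it proposes
`a₀ = 1 + log(e^{−2bt} + r(1 − e^{−2bt}))/bt` (the inverse distribution function of the density
`∝ e^{bt a₀}` on `[−1, 1]`), clipped to `[−1, 1]`, and accepts iff `r₂² ≤ 1 − a₀²`; when `bt = 0`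
EXACTLY (the zero-staple branch of `update_link`, where the link's conditional law is Haar) it
proposes `a₀ = 2r − 1` instead.  In idealised real arithmetic:

* §1 a generic lemma for "propose `a₀ = prop(r)`, accept iff `r₂² ≤ 1 − a₀²`"
  (`sqrtThinRound prop`): if the proposal has a density `d` on `(−1, 1)` with
  `d(t)√(1−t²) = K · (2/π)√(1−t²)e^{ct}` there, the accepted part of a round is `K • a0Law c`
  (**`sqrtThinRound_apply_prod_true`**) and the loop outputs `(a0Law c ℝ)⁻¹ • a0Law c`
  (**`loopLaw_sqrtThinRound`**);
* §2 **`lintegral_creutzProposal`** — for `bt > 0` the clipped inverse-CDF proposal has density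
  `bt e^{bt(t−1)}/(1 − e^{−2bt})` on `(−1, 1)` (change of variables along the distribution
  function); **`loopLaw_creutzRound`** — THE CREUTZ LOOP IS EXACT: it outputs the normalised A3
  law `(a0Law bt ℝ)⁻¹ • a0Law bt` for every `bt > 0`, with acceptance per round
  `(π/2)·bt e^{−bt}/(1−e^{−2bt}) · a0Law bt ℝ` (`creutzRound_accept`);
* §3 **`loopLaw_creutzRound₀`** — the `bt = 0` branch outputs `(a0Law 0 ℝ)⁻¹ • a0Law 0`, the
  semicircle law `(2/π)√(1−t²)dt` = the `a₀`-marginal of Haar (`SU2A0Marginal.lean`);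
* §4 END TO END (**`map_assembleSU2_loopLaw_creutzRound`**, `…₀`): with a uniform axis and
  `assembleSU2` the Creutz loop produces EXACTLY the normalised link law
  `(∫e^{bt a₀}dHaar)⁻¹ • e^{bt a₀(U)} dHaar(U)`, and the `bt = 0` loop produces Haar itself.

NOT CLAIMED: floating point; the round cap `it < 100000`; and one deliberate APPROXIMATION of
the engine that this file makes visible: for `0 < bt ≤ 10⁻¹²` the C code takes the `2r − 1`
proposal (guarding `log(…)/bt`), whose loop outputs the `c = 0` law, not `a0Law bt` — a
relative density error `≤ e^{2·10⁻¹²} − 1` on that (measure-zero in practice) parameter range.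
-/

namespace Summit.Ventures.LatticeQCDFlow.Exactness

open MeasureTheory Measure Set Real
open scoped ENNReal

/-! ## §1 Propose `a₀ = prop(r)`, accept iff `r₂² ≤ 1 − a₀²` -/

section Generic

variable {prop : ℝ → ℝ}

/-- One round "propose `a₀ = prop r`, accept iff `r₂² ≤ 1 − a₀²`" from two uniforms `(r, r₂)`. -/
noncomputable def sqrtThinStep (prop : ℝ → ℝ) (ω : ℝ × ℝ) : ℝ × Bool :=
  (prop ω.1, decide (ω.2 ^ 2 ≤ 1 - prop ω.1 ^ 2))

/-- `sqrtThinStep` is measurable for a measurable proposal map. -/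
theorem measurable_sqrtThinStep (hprop : Measurable prop) : Measurable (sqrtThinStep prop) := by
  unfold sqrtThinStep
  refine Measurable.prodMk (hprop.comp measurable_fst) (measurable_decide ?_)
  exact measurableSet_le (by fun_prop : Measurable fun ω : ℝ × ℝ => ω.2 ^ 2)
    ((hprop.comp measurable_fst).pow_const 2 |>.const_sub 1)

/-- The law of one such round on `ℝ × Bool`. -/
noncomputable def sqrtThinRound (prop : ℝ → ℝ) : Measure (ℝ × Bool) :=
  (unitLaw.prod unitLaw).map (sqrtThinStep prop)

/-- One round is a probability law. -/
theorem isProbabilityMeasure_sqrtThinRound (hprop : Measurable prop) :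
    IsProbabilityMeasure (sqrtThinRound prop) :=
  isProbabilityMeasure_map (measurable_sqrtThinStep hprop).aemeasurable

/-- The test `r₂² ≤ 1 − a²` accepts with probability `√(1 − a²)` (`= 0` for `|a| ≥ 1`). -/
theorem unitLaw_sq_le_one_sub_sq (a : ℝ) :
    unitLaw {r : ℝ | r ^ 2 ≤ 1 - a ^ 2} = ENNReal.ofReal (Real.sqrt (1 - a ^ 2)) := by
  rw [unitLaw_sq_le, min_eq_left]
  rw [show (1 : ℝ) = Real.sqrt 1 from Real.sqrt_one.symm]
  exact Real.sqrt_le_sqrt (by rw [Real.sqrt_one]; nlinarith [sq_nonneg a])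

/-- **Generic accepted part.**  If the proposal `prop r`, `r ∼ unitLaw`, has density `d` on
`(−1, 1)` and `d(t)·√(1−t²) = K·(2/π)√(1−t²)e^{ct}` there, then `P(a₀ ∈ A, accept) = K · a0Law c A`. -/
theorem sqrtThinRound_apply_prod_true (hprop : Measurable prop) {d : ℝ → ℝ}
    (hd : ∀ g : ℝ → ℝ≥0∞, Measurable g →
      ∫⁻ r, g (prop r) ∂unitLaw = ∫⁻ t in Ioo (-1) 1, ENNReal.ofReal (d t) * g t)
    {K : ℝ≥0∞} (hK : K ≠ ∞) {c : ℝ}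
    (hdens : ∀ t ∈ Ioo (-1 : ℝ) 1, ENNReal.ofReal (d t) * ENNReal.ofReal (Real.sqrt (1 - t ^ 2)) =
      K * ENNReal.ofReal (semicircleDensity t * Real.exp (c * t)))
    {A : Set ℝ} (hA : MeasurableSet A) :
    sqrtThinRound prop (A ×ˢ {true}) = K * a0Law c A := by
  have hS : MeasurableSet {ω : ℝ × ℝ | prop ω.1 ∈ A ∧ ω.2 ^ 2 ≤ 1 - prop ω.1 ^ 2} :=
    (hA.preimage (hprop.comp measurable_fst)).inter
      (measurableSet_le (by fun_prop : Measurable fun ω : ℝ × ℝ => ω.2 ^ 2)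
        ((hprop.comp measurable_fst).pow_const 2 |>.const_sub 1))
  have hpre : sqrtThinStep prop ⁻¹' (A ×ˢ {true}) =
      {ω : ℝ × ℝ | prop ω.1 ∈ A ∧ ω.2 ^ 2 ≤ 1 - prop ω.1 ^ 2} := by
    ext ω
    simp only [sqrtThinStep, mem_preimage, mem_prod, mem_singleton_iff, decide_eq_true_eq, mem_setOf_eq]
  rw [sqrtThinRound, Measure.map_apply (measurable_sqrtThinStep hprop) (hA.prod (measurableSet_singleton _)),
    hpre, Measure.prod_apply hS]
  have hslice : ∀ r : ℝ, unitLaw (Prod.mk r ⁻¹' {ω : ℝ × ℝ | prop ω.1 ∈ A ∧ ω.2 ^ 2 ≤ 1 - prop ω.1 ^ 2}) =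
      A.indicator (fun a => ENNReal.ofReal (Real.sqrt (1 - a ^ 2))) (prop r) := by
    intro r
    by_cases hr : prop r ∈ A
    · have : Prod.mk r ⁻¹' {ω : ℝ × ℝ | prop ω.1 ∈ A ∧ ω.2 ^ 2 ≤ 1 - prop ω.1 ^ 2} =
          {r₂ : ℝ | r₂ ^ 2 ≤ 1 - prop r ^ 2} := by
        ext r₂
        simp only [mem_preimage, mem_setOf_eq]
        exact ⟨fun h => h.2, fun h => ⟨hr, h⟩⟩
      rw [indicator_of_mem hr, this, unitLaw_sq_le_one_sub_sq]
    · have : Prod.mk r ⁻¹' {ω : ℝ × ℝ | prop ω.1 ∈ A ∧ ω.2 ^ 2 ≤ 1 - prop ω.1 ^ 2} = ∅ := by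
        ext r₂
        simp only [mem_preimage, mem_setOf_eq, mem_empty_iff_false, iff_false, not_and]
        exact fun h => absurd h hr
      rw [indicator_of_notMem hr, this, measure_empty]
  simp_rw [hslice]
  have hmeas : Measurable fun a : ℝ => ENNReal.ofReal (Real.sqrt (1 - a ^ 2)) := by fun_prop
  rw [hd _ (hmeas.indicator hA), a0Law, withDensity_apply _ hA, ← lintegral_indicator hA,
    ← lintegral_indicator measurableSet_Ioo, ← lintegral_const_mul' _ _ hK]
  refine lintegral_congr fun t => ?_
  by_cases htA : t ∈ A
  · by_cases ht : t ∈ Ioo (-1 : ℝ) 1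
    · rw [indicator_of_mem ht, indicator_of_mem htA, indicator_of_mem htA, hdens t ht]
    · rw [indicator_of_notMem ht, indicator_of_mem htA, semicircleDensity_eq_zero_of_one_le_abs, zero_mul,
        ENNReal.ofReal_zero, mul_zero]
      simp only [mem_Ioo, not_and_or, not_lt] at ht
      rcases ht with ht | ht
      · rw [abs_of_nonpos (by linarith)]; linarith
      · rw [abs_of_nonneg (by linarith)]; exact ht
  · by_cases ht : t ∈ Ioo (-1 : ℝ) 1
    · simp only [indicator_of_mem ht, indicator_of_notMem htA, mul_zero]
    · rw [indicator_of_notMem ht, indicator_of_notMem htA, mul_zero]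

/-- **Generic exactness of "inverse-CDF proposal + `√(1−a₀²)` thinning".**  Under the hypotheses of
`sqrtThinRound_apply_prod_true` with `0 < K < ∞`, the repeat-until-accept loop outputs the
normalised A3 law `(a0Law c ℝ)⁻¹ • a0Law c`, and accepts with probability `K · a0Law c ℝ` per round. -/
theorem loopLaw_sqrtThinRound (hprop : Measurable prop) {d : ℝ → ℝ}
    (hd : ∀ g : ℝ → ℝ≥0∞, Measurable g →
      ∫⁻ r, g (prop r) ∂unitLaw = ∫⁻ t in Ioo (-1) 1, ENNReal.ofReal (d t) * g t)
    {K : ℝ≥0∞} (hK0 : K ≠ 0) (hK : K ≠ ∞) {c : ℝ}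
    (hdens : ∀ t ∈ Ioo (-1 : ℝ) 1, ENNReal.ofReal (d t) * ENNReal.ofReal (Real.sqrt (1 - t ^ 2)) =
      K * ENNReal.ofReal (semicircleDensity t * Real.exp (c * t))) :
    sqrtThinRound prop (univ ×ˢ {true}) = K * a0Law c univ ∧
      loopLaw (sqrtThinRound prop) = (a0Law c univ)⁻¹ • a0Law c ∧
      IsProbabilityMeasure (loopLaw (sqrtThinRound prop)) := by
  haveI := isProbabilityMeasure_sqrtThinRound hprop
  have hacc : accPart (sqrtThinRound prop) = K • a0Law c := by
    ext A hA
    rw [accPart_apply hA, Measure.smul_apply, smul_eq_mul, sqrtThinRound_apply_prod_true hprop hd hK hdens hA]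
  have huniv : sqrtThinRound prop (univ ×ˢ {true}) = K * a0Law c univ :=
    sqrtThinRound_apply_prod_true hprop hd hK hdens MeasurableSet.univ
  refine ⟨huniv, ?_, isProbabilityMeasure_loopLaw (by
    rw [huniv]; exact mul_ne_zero hK0 (a0Law_univ_ne_zero c))⟩
  rw [loopLaw_eq, huniv, hacc, smul_smul, ENNReal.mul_inv (Or.inl hK0) (Or.inl hK), mul_comm K⁻¹,
    mul_assoc, ENNReal.inv_mul_cancel hK0 hK, mul_one]

end Generic

/-! ## §2 Creutz's branch, `bt > 0` -/

section Creutz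

variable {bt : ℝ}

/-- **Creutz's proposal as the engine computes it**: `a₀ = 1 + log(e^{−2bt} + r(1−e^{−2bt}))/bt`,
clipped to `[−1, 1]`. -/
noncomputable def creutzProposal (bt r : ℝ) : ℝ :=
  max (-1) (min 1 (1 + Real.log (Real.exp (-2 * bt) + r * (1 - Real.exp (-2 * bt))) / bt))

/-- The proposal map is measurable. -/
theorem measurable_creutzProposal (bt : ℝ) : Measurable (creutzProposal bt) := by
  unfold creutzProposal
  fun_prop

/-- The distribution function being inverted: `t ↦ (e^{bt(t−1)} − e^{−2bt})/(1 − e^{−2bt})`. -/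
noncomputable def creutzInv (bt t : ℝ) : ℝ :=
  (Real.exp (bt * (t - 1)) - Real.exp (-2 * bt)) / (1 - Real.exp (-2 * bt))

/-- `e^{−2bt} < 1` for `bt > 0`. -/
theorem exp_neg_two_mul_lt_one (hbt : 0 < bt) : Real.exp (-2 * bt) < 1 :=
  Real.exp_lt_one_iff.mpr (by linarith)

/-- On `(−1, 1)` the proposal map inverts `creutzInv`. -/
theorem creutzProposal_creutzInv (hbt : 0 < bt) {t : ℝ} (ht : t ∈ Ioo (-1 : ℝ) 1) :
    creutzProposal bt (creutzInv bt t) = t := by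
  have hem := exp_neg_two_mul_lt_one hbt
  rw [creutzProposal, creutzInv, div_mul_cancel₀ _ (by linarith), add_sub_cancel, Real.log_exp,
    mul_div_cancel_left₀ _ hbt.ne', add_sub_cancel, min_eq_right ht.2.le, max_eq_right ht.1.le]

/-- `creutzInv` maps `(−1, 1)` onto `(0, 1)`. -/
theorem image_creutzInv (hbt : 0 < bt) : creutzInv bt '' Ioo (-1) 1 = Ioo 0 1 := by
  have hem := exp_neg_two_mul_lt_one hbt
  have hem0 : 0 < 1 - Real.exp (-2 * bt) := by linarith
  ext r
  constructor
  · rintro ⟨t, ht, rfl⟩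
    rw [creutzInv]
    have h1 : Real.exp (-2 * bt) < Real.exp (bt * (t - 1)) := Real.exp_lt_exp.mpr (by nlinarith [ht.1])
    have h2 : Real.exp (bt * (t - 1)) < 1 := Real.exp_lt_one_iff.mpr (by nlinarith [ht.2])
    exact ⟨div_pos (by linarith) hem0, (div_lt_one hem0).mpr (by linarith)⟩
  · rintro ⟨h0, h1⟩
    have hpos : 0 < Real.exp (-2 * bt) + r * (1 - Real.exp (-2 * bt)) := by positivity
    refine ⟨1 + Real.log (Real.exp (-2 * bt) + r * (1 - Real.exp (-2 * bt))) / bt, ⟨?_, ?_⟩, ?_⟩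
    · -- `−1 < t`
      have : -2 * bt < Real.log (Real.exp (-2 * bt) + r * (1 - Real.exp (-2 * bt))) := by
        have h := Real.log_lt_log (Real.exp_pos (-2 * bt))
          (show Real.exp (-2 * bt) < Real.exp (-2 * bt) + r * (1 - Real.exp (-2 * bt)) by nlinarith)
        rwa [Real.log_exp] at h
      have : -2 < Real.log (Real.exp (-2 * bt) + r * (1 - Real.exp (-2 * bt))) / bt := by
        rw [lt_div_iff₀ hbt]; linarith
      linarith
    · -- `t < 1`
      have : Real.log (Real.exp (-2 * bt) + r * (1 - Real.exp (-2 * bt))) < 0 :=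
        Real.log_neg hpos (by nlinarith)
      have : Real.log (Real.exp (-2 * bt) + r * (1 - Real.exp (-2 * bt))) / bt < 0 :=
        div_neg_of_neg_of_pos this hbt
      linarith
    · rw [creutzInv, add_sub_cancel_left, mul_div_cancel₀ _ hbt.ne', Real.exp_log hpos, add_sub_cancel_left,
        mul_div_assoc, div_self hem0.ne', mul_one]

/-- Derivative of `creutzInv`: `bt e^{bt(t−1)}/(1 − e^{−2bt})`. -/
theorem hasDerivAt_creutzInv (bt t : ℝ) :
    HasDerivAt (creutzInv bt) (bt * Real.exp (bt * (t - 1)) / (1 - Real.exp (-2 * bt))) t := by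
  have h := ((((hasDerivAt_id' t).sub_const 1).const_mul bt).exp.sub_const (Real.exp (-2 * bt))).div_const
    (1 - Real.exp (-2 * bt))
  exact h.congr_deriv (by ring)

/-- **The law of Creutz's proposal**: for `bt > 0` and every `g ≥ 0`,
`∫ g(creutzProposal bt r) d unitLaw(r) = ∫_{(−1,1)} bt e^{bt(t−1)}/(1−e^{−2bt}) g(t) dt` — the density
`∝ e^{bt t}` on `[−1, 1]`, by the change of variables along the distribution function. -/
theorem lintegral_creutzProposal (hbt : 0 < bt) (g : ℝ → ℝ≥0∞) :
    ∫⁻ r, g (creutzProposal bt r) ∂unitLaw =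
      ∫⁻ t in Ioo (-1) 1, ENNReal.ofReal (bt * Real.exp (bt * (t - 1)) / (1 - Real.exp (-2 * bt))) * g t := by
  have hem0 : 0 < 1 - Real.exp (-2 * bt) := by linarith [exp_neg_two_mul_lt_one hbt]
  have hinj : InjOn (creutzInv bt) (Ioo (-1) 1) := by
    intro s hs t ht h
    rw [← creutzProposal_creutzInv hbt hs, ← creutzProposal_creutzInv hbt ht, h]
  rw [lintegral_unitLaw, ← image_creutzInv hbt,
    lintegral_image_eq_lintegral_abs_deriv_mul measurableSet_Ioo
      (fun t _ => (hasDerivAt_creutzInv bt t).hasDerivWithinAt) hinj]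
  refine setLIntegral_congr_fun measurableSet_Ioo fun t ht => ?_
  rw [creutzProposal_creutzInv hbt ht, abs_of_pos (by positivity)]

/-- **One Creutz round** (`bt > 0`): the law on `ℝ × Bool` of (proposed `a₀`, accept-bit). -/
noncomputable def creutzRound (bt : ℝ) : Measure (ℝ × Bool) := sqrtThinRound (creutzProposal bt)

/-- Creutz's constant `K'(bt) = (π/2) · bt e^{−bt}/(1 − e^{−2bt})`. -/
noncomputable def creutzConst (bt : ℝ) : ℝ≥0∞ :=
  ENNReal.ofReal (π / 2 * (bt * Real.exp (-bt) / (1 - Real.exp (-2 * bt))))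

/-- The density identity on `(−1, 1)`: `bt e^{bt(t−1)}/(1−e^{−2bt}) · √(1−t²) = K'(bt) · (2/π)√(1−t²) e^{bt t}`. -/
theorem creutz_pointwise (hbt : 0 < bt) (t : ℝ) :
    ENNReal.ofReal (bt * Real.exp (bt * (t - 1)) / (1 - Real.exp (-2 * bt))) *
        ENNReal.ofReal (Real.sqrt (1 - t ^ 2)) =
      creutzConst bt * ENNReal.ofReal (semicircleDensity t * Real.exp (bt * t)) := by
  have hem0 : 0 < 1 - Real.exp (-2 * bt) := by linarith [exp_neg_two_mul_lt_one hbt]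
  rw [creutzConst, ← ENNReal.ofReal_mul (by positivity), ← ENNReal.ofReal_mul (by positivity)]
  congr 1
  rw [semicircleDensity, show bt * (t - 1) = -bt + bt * t by ring, Real.exp_add]
  field_simp

/-- **THE CREUTZ LOOP IS EXACT** (`bt > 0`): acceptance per round `K'(bt) · a0Law bt ℝ`, output law
`(a0Law bt ℝ)⁻¹ • a0Law bt`, halting almost surely. -/
theorem loopLaw_creutzRound (hbt : 0 < bt) :
    creutzRound bt (univ ×ˢ {true}) = creutzConst bt * a0Law bt univ ∧
      loopLaw (creutzRound bt) = (a0Law bt univ)⁻¹ • a0Law bt ∧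
      IsProbabilityMeasure (loopLaw (creutzRound bt)) := by
  have hem0 : 0 < 1 - Real.exp (-2 * bt) := by linarith [exp_neg_two_mul_lt_one hbt]
  have hK0 : creutzConst bt ≠ 0 := by
    rw [creutzConst, Ne, ENNReal.ofReal_eq_zero, not_le]; positivity
  exact loopLaw_sqrtThinRound (measurable_creutzProposal bt)
    (fun g _ => lintegral_creutzProposal hbt g) hK0 ENNReal.ofReal_ne_top
    (fun t _ => creutz_pointwise hbt t)

/-- **End to end, Creutz branch**: the loop's `a₀`, a uniform axis and `assembleSU2` produce EXACTLY
the normalised SU(2) one-link heat-bath law. -/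
theorem map_assembleSU2_loopLaw_creutzRound (hbt : 0 < bt) :
    ((loopLaw (creutzRound bt)).prod (uniformSphere (volume : Measure E3))).map assembleSU2 =
      ((Literature.MathematicalPhysics.QuantumFieldTheory.haarProbability
          (Matrix.specialUnitaryGroup (Fin 2) ℂ)).withDensity
            (fun U => ENNReal.ofReal (Real.exp (bt * su2a0 U))) univ)⁻¹ •
        (Literature.MathematicalPhysics.QuantumFieldTheory.haarProbability
          (Matrix.specialUnitaryGroup (Fin 2) ℂ)).withDensity
            (fun U => ENNReal.ofReal (Real.exp (bt * su2a0 U))) := by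
  rw [(loopLaw_creutzRound hbt).2.1, Measure.prod_smul_left, Measure.map_smul, map_assembleSU2_a0Law,
    a0Law_univ_eq]

end Creutz

/-! ## §3 The `bt = 0` branch: `a₀ = 2r − 1`, thinning by `√(1−a₀²)` gives the semicircle law -/

section Zero

/-- The engine's proposal at `bt = 0`: `a₀ = 2r − 1`, clipped. -/
noncomputable def creutzProposal₀ (r : ℝ) : ℝ := max (-1) (min 1 (2 * r - 1))

/-- It is measurable. -/
theorem measurable_creutzProposal₀ : Measurable creutzProposal₀ := by
  unfold creutzProposal₀; fun_prop

/-- The law of `2r − 1`: density `1/2` on `(−1, 1)`. -/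
theorem lintegral_creutzProposal₀ (g : ℝ → ℝ≥0∞) :
    ∫⁻ r, g (creutzProposal₀ r) ∂unitLaw = ∫⁻ t in Ioo (-1) 1, ENNReal.ofReal (1 / 2) * g t := by
  have himg : (fun t : ℝ => (t + 1) / 2) '' Ioo (-1) 1 = Ioo 0 1 := by
    ext r
    constructor
    · rintro ⟨t, ht, rfl⟩; exact ⟨by linarith [ht.1], by linarith [ht.2]⟩
    · intro hr; exact ⟨2 * r - 1, ⟨by linarith [hr.1], by linarith [hr.2]⟩, by ring⟩
  have hderiv : ∀ t ∈ Ioo (-1 : ℝ) 1, HasDerivWithinAt (fun t : ℝ => (t + 1) / 2) (1 / 2) (Ioo (-1) 1) t :=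
    fun t _ => (((hasDerivAt_id' t).add_const 1).div_const 2).hasDerivWithinAt
  have hinj : InjOn (fun t : ℝ => (t + 1) / 2) (Ioo (-1) 1) := fun s _ t _ h => by
    simpa using h
  rw [lintegral_unitLaw, ← himg, lintegral_image_eq_lintegral_abs_deriv_mul measurableSet_Ioo hderiv hinj]
  refine setLIntegral_congr_fun measurableSet_Ioo fun t ht => ?_
  rw [abs_of_pos (by norm_num : (0 : ℝ) < 1 / 2), creutzProposal₀,
    show 2 * ((t + 1) / 2) - 1 = t by ring, min_eq_right ht.2.le, max_eq_right ht.1.le]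

/-- **One round at `bt = 0`.** -/
noncomputable def creutzRound₀ : Measure (ℝ × Bool) := sqrtThinRound creutzProposal₀

/-- **THE `bt = 0` LOOP IS EXACT**: acceptance `π/4` per round, output `(a0Law 0 ℝ)⁻¹ • a0Law 0` —
the semicircle law `(2/π)√(1−t²) dt`, the `a₀`-marginal of Haar on SU(2). -/
theorem loopLaw_creutzRound₀ :
    creutzRound₀ (univ ×ˢ {true}) = ENNReal.ofReal (π / 4) * a0Law 0 univ ∧
      loopLaw creutzRound₀ = (a0Law 0 univ)⁻¹ • a0Law 0 ∧
      IsProbabilityMeasure (loopLaw creutzRound₀) := by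
  refine loopLaw_sqrtThinRound measurable_creutzProposal₀ (fun g _ => lintegral_creutzProposal₀ g)
    (by rw [Ne, ENNReal.ofReal_eq_zero, not_le]; positivity) ENNReal.ofReal_ne_top fun t _ => ?_
  rw [← ENNReal.ofReal_mul (by norm_num), ← ENNReal.ofReal_mul (by positivity), zero_mul, Real.exp_zero,
    mul_one, semicircleDensity]
  congr 1
  field_simp
  ring

/-- **End to end, `bt = 0`**: the loop's `a₀`, a uniform axis and `assembleSU2` produce EXACTLY the
Haar probability measure of SU(2) (the conditional law of a link with zero staple). -/
theorem map_assembleSU2_loopLaw_creutzRound₀ :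
    ((loopLaw creutzRound₀).prod (uniformSphere (volume : Measure E3))).map assembleSU2 =
      Literature.MathematicalPhysics.QuantumFieldTheory.haarProbability
        (Matrix.specialUnitaryGroup (Fin 2) ℂ) := by
  rw [loopLaw_creutzRound₀.2.1, Measure.prod_smul_left, Measure.map_smul, map_assembleSU2_a0Law,
    a0Law_univ_eq]
  simp only [zero_mul, Real.exp_zero, ENNReal.ofReal_one]
  rw [show (fun _ : Matrix.specialUnitaryGroup (Fin 2) ℂ => (1 : ℝ≥0∞)) = 1 from rfl, withDensity_one,
    measure_univ, inv_one, one_smul]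

end Zero

end Summit.Ventures.LatticeQCDFlow.Exactness
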